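import Mathlib.RingTheory.RegularLocalRing.Defs
import Mathlib.RingTheory.Valuation.ValuationSubring
import Mathlib.RingTheory.KrullDimension.Basic
import Mathlib.RingTheory.AlgebraicIndependent.Basic
import Mathlib.FieldTheory.IntermediateField.Adjoin.Defs
import Mathlib.FieldTheory.Separable
import Mathlib.LinearAlgebra.Matrix.Determinant.Basic
import Mathlib.Algebra.MvPolynomial.PDeriv
import Mathlib.Algebra.CharP.Lemmas
import Mathlib.RingTheory.Polynomial.UniqueFactorization
import Mathlib.RingTheory.IntegralClosure.IntegrallyClosed
import Mathlib.RingTheory.IntegralClosure.IsIntegralClosure.Basic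
import Literature.AlgebraicGeometry.Resolution.ValuationDefect
import HarnessLib

/-!
# Barrier: local monomialization fails in positive characteristic (Cutkosky's counterexample, defect `2`)

`Literature/Barriers/ResolutionOfSingularities/LocalMonomializationFails.lean` — barrier
catalogue entry (D-0021) for the summit `ResolutionOfSingularities`. NAMED FACT (the theorem
as printed, with its technique class — monomial extensions and (weak) local monomialization
along a valuation — as explicit Lean definitions), plus the printed example data PROVED as
polynomial identities.

## What the source prints (verified on the page: arXiv:1404.7459 = Math. Ann. 362 (2015) 321–334)

* Cutkosky, §1, verbatim: "A possible notion of a local simple morphism is that of monomial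
  inclusion of regular local rings. We call such a map a monomial extension. Simplification by
  performing monoidal transforms is called local monomialization. In characteristic zero,
  local monomialization is a good definition of simplification as a local monomialization can
  always be achieved along any valuation ([C] and [C2]). In characteristic `p > 0`, it is
  shown in [CP] that local monomialization is true for generically finite maps of surfaces,
  if the extension of valuation rings is defectless (a condition which is always true in
  characteristic zero). … It is natural to ask if local monomialization can always be
  achieved in positive characteristic. In this paper we give an example (Theorem 1.4) showing
  that this is not the case. The example even shows the failure of 'weak local
  monomialization' in positive characteristic."
  §1.1: "Suppose that `K*/K` is a finite separable field extension, `S` is an excellent local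
  ring of `K*` (`S` has quotient field `QF(S) = K*`) and `R` is an excellent local ring of `K`
  such that `dim S = dim R`, `S` dominates `R` (`R ⊂ S` and the maximal ideals `m_S` of `S` and
  `m_R` of `R` satisfy `m_S ∩ R = m_R`) and `ν*` is a valuation of `K*` which dominates `S`
  (the valuation ring `V_{ν*}` of `ν*` dominates `S`)."
  **Definition 1.1.** "`R → S` is monomial if `R` and `S` are regular local rings of the same
  dimension `n` and there exist regular systems of parameters `x₁,…,xₙ` in `R` and `y₁,…,yₙ`
  in `S`, units `δ₁,…,δₙ` in `S` and an `n × n` matrix `A = (aᵢⱼ)` of natural numbers with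
  nonzero determinant such that `xᵢ = δᵢ ∏ⱼ yⱼ^{aᵢⱼ}` for `1 ≤ i ≤ n`."
  **Definition 1.2** (local monomialization of `R → S` along `ν*`: a commutative diagram
  `R → R₁`, `S → S₁ ⊂ V_{ν*}` with vertical arrows "products of monoidal transforms" and
  `R₁ → S₁` monomial); "It is proven in Theorem 1.1 [C] that a local monomialization always
  exists when `K*/K` are algebraic function fields over a (not necessarily algebraically
  closed) field `k` of characteristic 0, and `R → S` are algebraic local rings of `K` and `K*`
  respectively. (An algebraic local ring is essentially of finite type over `k`.) We can also
  define the weaker notion of a weak local monomialization by only requiring that the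
  conclusions of Definition 1.2 hold with the vertical arrows being required to be birational
  (and not necessarily factorizable by products of monoidal transforms)."
  **Question 1.3.** "Does there always exist a local monomialization (or at least a weak local
  monomialization) of extensions `R → S` of excellent local rings dominated by a valuation
  `ν*`?" … "For the question to have a positive answer in positive characteristic or mixed
  characteristic it is of course necessary that some form of resolution of singularities be
  true." [cite: Cutkosky2014, §1 and §1.1 (Defs. 1.1, 1.2, Question 1.3)]
* **Theorem 1.4** (Counterexample to local and weak local monomialization), verbatim: "Let `k`
  be a field of characteristic `p > 0` with at least 3 elements and let `n ≥ 2`. Then there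
  exists a finite separable extension `K*/K` of `n` dimensional function fields over `k`, a
  valuation `ν*` of `K*` with restriction `ν` to `K` and algebraic regular local rings `A` and
  `B` of `K` and `K*` respectively, such that `B` dominates `A`, `ν*` dominates `B` and there
  do not exist regular algebraic local rings `A'` of `K` and `B'` of `K*` such that `ν*`
  dominates `B'`, `B'` dominates `A'`, `A'` dominates `A`, `B'` dominates `B` and `A' → B'` is
  monomial. We have that the defect `δ(ν*/ν) = 2` in the example of Theorem 1.4".
  [cite: Cutkosky2014, Thm. 1.4]
* §1 (continued): "In [CP], we show that strong local monomialization is true for defectless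
  extensions of two dimensional algebraic function fields (Theorem 7.3 and Theorem 7.35 [CP]).
  This result is extended in [C3] to defectless extensions of 2 dimensional regular local
  rings. We give an example in [CP] (Theorem 7.38 [CP]) showing that strong local
  monomialization is not generally true for defect extensions of two dimensional algebraic
  function fields (over a field of positive characteristic). However, local monomialization
  is true for this example". "Birational properties of two dimensional regular local rings
  along a valuation are generally the same in positive and mixed characteristic as in
  characteristic zero …, but properties related to ramification are very different".
  [cite: Cutkosky2014, §1]
* §2.1: "If `K` is an algebraic function field over a field `k` … and a local ring `R` of `K`
  is essentially of finite type over `k`, then we say that `R` is an algebraic local ring of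
  `k`"; "We will say that `S` dominates `R` if `m_S ∩ R = m_R`". §3 (the example for `n = 2`):
  "Let `K*` be the two dimensional rational function field `K* = k(x,y)`. Let
  `u = xᵖ(1+y)`, `v = yᵖ + x`, and let `K` be the two dimensional rational function field
  `K = k(u,v)`. `K*` is separable over `K` since the Jacobian of `u` and `v` is not zero. We
  have that `K* = K(y)` and `y` satisfies the relation `y^{p²+1} + y^{p²} − yvᵖ + (u − vᵖ) = 0`,
  so `K*` is a finite extension of `K`. Let `A = A₀ = k[u,v]_{(u,v)}` and `B = k[x,y]_{(x,y)}`."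
  [cite: Cutkosky2014, §2.1 and §3]

## Lean rendering

Everything takes place inside one field `L = K*` containing `k`; `K` is an intermediate field.
Sub-namespace `Cutkosky`. For subrings `R ⊆ S` of a field, "`S` dominates `R`"
(`m_S ∩ R = m_R`) is rendered as: `R ≤ S` and every element of `R` invertible in `S` is
invertible in `R` (`Dominates`, `ValuationDominates`) — for local `R`, `S` this is the printed
condition. "Algebraic local ring `A` of `F`" (`IsAlgebraicLocalRingOf F A`): `A ⊆ F` is a local
ring with quotient field `F` which is the localisation `R_{𝔪_A ∩ R}` of a finitely generated
`k`-subalgebra `R ≤ A` (every `x ∈ A` is `r/s` with `r, s ∈ R`, `s` invertible in `A`).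
`IsMonomialExtension R S` is Definition 1.1 verbatim for an `R`-algebra `S` ("same dimension
`n`" = `ringKrullDim`; regular systems of parameters = `n` generators of the maximal ideal of
the `n`-dimensional regular local ring; `det ≠ 0` over `ℤ`). The named fact `Cutkosky2014`
transcribes Theorem 1.4 and carries the D-0021 block. PROVED: the printed relation for `y` over `K = k(u,v)` and the
Jacobian `∂(u,v)/∂(x,y) = −xᵖ ≠ 0`, as identities in `k[x,y]` (`cutkosky_relation`,
`cutkosky_jacobian`).

## Barrier audit (2026-08-16): the technique class and reach, NARROWED

The theorem is correct and is PROVED in the tree (`Cutkosky2014_holds`,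
`LocalMonomializationFailsHolds.lean`). What the audit narrows is the D-0021 block: (1) DEFECT is
the only obstruction in dimension two — Cutkosky, Comm. Algebra 44 (2016) 2828–2866
(= arXiv:1508.03362), Thm. 1.4: defectless extensions of two-dimensional excellent local domains
have (stable, strong) local monomializations in every characteristic; its contrapositive in the
setting of this file is the named fact `Cutkosky2014Narrow` (no weak local monomialization ⇒
`(K, ν)` is not defectless in `K*`); (2) the counterexample is a FINITE morphism of regular
surfaces: `k[x, y]` is the integral closure of `k[u, v]` in `k(x, y)` (PROVED:
`cutkosky_isIntegral_y`, `cutkosky_isIntegral_x`, `cutkosky_algebra_isIntegral`,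
`cutkosky_isIntegralClosure`), so `B = k[x,y]_{(x,y)}` lies over `A = k[u,v]_{(u,v)}` and weak
(local) simultaneous resolution along `ν*` HOLDS in the example — the theorem obstructs the
monomial form, not simultaneous-resolution techniques; (3) the printed positive results evading
it (tame extensions, Cutkosky–Piltant 2000; single Artin–Schreier layers with `p`-divisible value
group, from Cutkosky, Math. Nachr. 296 (2023), Props. 3.9, 5.1, 5.3; the defect-`p²` tower of
[CP] Thm. 7.38, which IS locally monomializable) are recorded in the block of
`Cutkosky2014Narrow`.
-/

noncomputable section

open IsLocalRing

namespace Literature.Barriers.ResolutionOfSingularities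

namespace Cutkosky

universe u

/-! ## The technique class: monomial extensions (Definition 1.1) -/

/-- **Monomial extension** (Cutkosky, Def. 1.1): `R → S` is *monomial* if `R` and `S` are
regular local rings of the same dimension `n` and there are regular systems of parameters
`x₁,…,xₙ` of `R`, `y₁,…,yₙ` of `S`, units `δᵢ ∈ S` and a matrix `(aᵢⱼ) ∈ ℕ^{n×n}` with
`det ≠ 0` such that `xᵢ = δᵢ ∏ⱼ yⱼ^{aᵢⱼ}`. (A regular system of parameters of the regular local
ring `R` of dimension `n` is a family of `n` elements generating `𝔪_R`.) [cite: Cutkosky2014, Def. 1.1] -/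
def IsMonomialExtension (R S : Type*) [CommRing R] [CommRing S] [Algebra R S] : Prop :=
  IsRegularLocalRing R ∧ IsRegularLocalRing S ∧
  ∃ n : ℕ, ringKrullDim R = n ∧ ringKrullDim S = n ∧
    ∃ (_ : IsLocalRing R) (_ : IsLocalRing S) (x : Fin n → R) (y : Fin n → S) (δ : Fin n → Sˣ)
      (a : Matrix (Fin n) (Fin n) ℕ),
      Ideal.span (Set.range x) = maximalIdeal R ∧ Ideal.span (Set.range y) = maximalIdeal S ∧
      (a.map (Nat.cast : ℕ → ℤ)).det ≠ 0 ∧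
      ∀ i, algebraMap R S (x i) = (δ i : S) * ∏ j, y j ^ a i j

/-! ## Local rings of a function field inside an ambient field `L ⊇ k` -/

section Setting

variable (k : Type u) (L : Type u) [Field k] [Field L] [Algebra k L]

/-- For subrings `A ≤ B` of the field `L`: **`B` dominates `A`** — every element of `A` that is
invertible in `B` is invertible in `A`; for local rings this is the printed `m_B ∩ A = m_A`.
[cite: Cutkosky2014, §1.1 and §2.1] -/
def Dominates (A B : Subalgebra k L) : Prop :=
  A ≤ B ∧ ∀ x ∈ A, x⁻¹ ∈ B → x⁻¹ ∈ A

/-- **The valuation `ν` (valuation ring `V`) dominates `B`**: `B ⊆ V` and `m_V ∩ B = m_B`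
(for local `B`: the centre `𝔪_V ∩ B` of `V` on `B` — the tree's `Literature.AlgebraicGeometry.Resolution.centreIdeal` /
`subringCentre` of `LocalUniformization.lean`, `LocalBlowup.lean` — is the maximal ideal of `B`;
`V ⊇ B ⊇ k`, so `ν` is automatically a `k`-valuation). [cite: Cutkosky2014, §1.1 and §2.2] -/
def ValuationDominates (V : ValuationSubring L) (B : Subalgebra k L) : Prop :=
  B.toSubring ≤ V.toSubring ∧ ∀ x ∈ B, x⁻¹ ∈ V → x⁻¹ ∈ B

/-- **Algebraic local ring `A` of the function field `F ⊆ L`** (Cutkosky §2.1: a local ring of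
`F` — a local domain with quotient field `F` — essentially of finite type over `k`): `A ⊆ F` is
local, every element of `F` is a quotient of elements of `A`, and `A` is the localisation at
`𝔪_A ∩ R` of a finitely generated `k`-subalgebra `R ≤ A` (each `x ∈ A` is `r/s` with `r, s ∈ R`
and `s` invertible in `A`). [cite: Cutkosky2014, §2.1] -/
def IsAlgebraicLocalRingOf (F : IntermediateField k L) (A : Subalgebra k L) : Prop :=
  IsLocalRing A ∧ (A : Set L) ⊆ F ∧
  (∀ x ∈ F, ∃ a ∈ A, ∃ b ∈ A, b ≠ 0 ∧ x = a / b) ∧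
  ∃ R : Subalgebra k L, R.FG ∧ R ≤ A ∧
    ∀ x ∈ A, ∃ r ∈ R, ∃ s ∈ R, s ≠ 0 ∧ s⁻¹ ∈ A ∧ x = r / s

/-- `L` is an **`n`-dimensional (algebraic) function field over `k`**: finitely generated of
transcendence degree `n`. [cite: Cutkosky2014, Thm. 1.4 ("n dimensional function fields over k")] -/
def IsFunctionFieldOfDim (n : ℕ) : Prop :=
  (⊤ : IntermediateField k L).FG ∧ Algebra.trdeg k L = n

variable {k L} in
/-- The inclusion `A ≤ B` of subalgebras as an algebra structure (to speak of `A → B` being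
monomial). [folklore] -/
abbrev inclusionAlgebra {A B : Subalgebra k L} (h : A ≤ B) : Algebra A B :=
  (Subalgebra.inclusion h).toRingHom.toAlgebra

/-- **Weak local monomialization fails for `(A → B, ν*)`** (the negated conclusion of Thm. 1.4):
there are no algebraic regular local rings `A'` of `K` and `B'` of `K* = L` with `ν*`
dominating `B'`, `B'` dominating `A'`, `A'` dominating `A`, `B'` dominating `B`, and `A' → B'`
monomial. [cite: Cutkosky2014, Thm. 1.4 and §1.1 (weak local monomialization)] -/
def NoWeakLocalMonomialization (K : IntermediateField k L) (V : ValuationSubring L)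
    (A B : Subalgebra k L) : Prop :=
  ¬ ∃ (A' B' : Subalgebra k L) (h : A' ≤ B'),
      IsAlgebraicLocalRingOf k L K A' ∧ IsAlgebraicLocalRingOf k L ⊤ B' ∧
      IsRegularLocalRing A' ∧ IsRegularLocalRing B' ∧
      ValuationDominates k L V B' ∧ Dominates k L A' B' ∧ Dominates k L A A' ∧
      Dominates k L B B' ∧
      @IsMonomialExtension A' B' _ _ (inclusionAlgebra h)

end Setting

/-! ## The named fact: Theorem 1.4 -/

/-- NAMED FACT — **Cutkosky's counterexample to local and weak local monomialization in
positive characteristic** (Thm. 1.4, as printed): for every field `k` of characteristic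
`p > 0` with at least three elements and every `n ≥ 2` there are a finite separable extension
`K*/K` of `n`-dimensional function fields over `k` (here `K* = L`, `K ≤ L`), a valuation ring
`V = V_{ν*}` of `K*` over `k`, and algebraic regular local rings `A` of `K`, `B` of `K*` with
`B` dominating `A` and `ν*` dominating `B`, such that NO algebraic regular local rings
`A' ⊇ A` of `K`, `B' ⊇ B` of `K*` along `ν*` (all dominations as printed) make `A' → B'`
monomial. (The defect of `ν*/ν` in the example is `2`; `n = 2`: `K* = k(x,y)`,
`K = k(xᵖ(1+y), yᵖ + x)`, `A = k[u,v]_{(u,v)}`, `B = k[x,y]_{(x,y)}`.) Users take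
`(h : Cutkosky2014)`. [cite: Cutkosky2014, Thm. 1.4]

**BARRIER (D-0021 block).**

- technique_class: local-monomialization weak-local-monomialization strong-local-monomialization monomialization-along-valuation monomial-extension simultaneous-resolution-along-valuation ramification-of-valuations toroidalization-along-valuation cutkosky-monomialization-transfer
- blocks: (technique in words: (weak) local monomialization along a valuation — replacing a dominant, generically finite extension `R → S` of regular algebraic local rings, dominated by a valuation `ν*`, by a MONOMIAL extension `R₁ → S₁` (Def. 1.1, `IsMonomialExtension`) after monoidal transforms (Def. 1.2) or just birationally (weak form, `NoWeakLocalMonomialization`); in characteristic zero this "can always be achieved along any valuation ([C] and [C2])", and strong monomialization "encodes the classical invariants of the extension of valuation rings". [cite: Cutkosky2014, §1, Defs. 1.1–1.2]) — a positive answer to Question 1.3 (local or weak local monomialization for extensions of excellent local rings dominated by a valuation) in characteristic `p > 0` and dimension `≥ 2` — hence any transposition to characteristic `p` of the characteristic-zero monomialization theorems [C], [C2] as a route to simultaneous resolution / ramification control along valuations ("For the question to have a positive answer in positive characteristic … it is of course necessary that some form of resolution of singularities be true"). [cite: Cutkosky2014, §1 (Question 1.3, Thm. 1.4)]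
- because: Theorem 1.4 (`Cutkosky2014`): over any field `k` of characteristic `p` with at least three elements, the extension `k[u,v]_{(u,v)} → k[x,y]_{(x,y)}`, `u = xᵖ(1+y)`, `v = yᵖ + x` (relation and Jacobian: `cutkosky_relation`, `cutkosky_jacobian`), with a suitable valuation `ν*` of `k(x,y)` built from iterated quadratic transforms (Lemma 3.1: the shape `u = xᵖ(c + fy + xΛ)`, `v = τ(y)yᵖ + ex + xΩ` reproduces itself after `p` quadratic transforms and is never monomial), admits no weak local monomialization; the defect is `δ(ν*/ν) = 2`. [cite: Cutkosky2014, Thm. 1.4, Lemma 3.1]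
- evasions_known: defectless extensions: local (indeed strong) monomialization holds for defectless extensions of two-dimensional algebraic function fields / regular local rings in characteristic `p` ([CP] Thms. 7.3, 7.35; [C3]) [cite: Cutkosky2014, §1]; characteristic zero: Cutkosky's Theorem 1.1 of [C] [cite: Cutkosky2014, §1.1]; local uniformization AFTER a finite extension of the function field (Knaf–Kuhlmann) or a purely inseparable one (Temkin), vendored in `Literature/AlgebraicGeometry/Resolution/LocalUniformization.lean` [cite: KnafKuhlmann2009, Thm. 1.2] [cite: Temkin2013, Thm. 1.3.2].
- scope_caveats: (a) the theorem concerns monomialization of EXTENSIONS `R → S` (pairs of local rings along a valuation), not resolution or local uniformization of a single variety: it does not assert that local uniformization fails in characteristic `p`; (b) the counterexample has defect `2` — nothing is claimed for defectless extensions, where the opposite holds; (c) `k` must have at least three elements and `n ≥ 2`; (d) the Lean fact renders "local ring of `K`" / domination set-theoretically inside `K* = L` (see the module docstring) and does not formalise Def. 1.2's "products of monoidal transforms" — only the weak (birational) form, whose failure is the stronger statement printed in Thm. 1.4; (e) AUDIT 2026-08-16 — reach narrowed, see `Cutkosky2014Narrow` below: in dimension two the failure FORCES defect (Cutkosky 2016,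 Thm. 1.4: defectless ⇒ strong local monomialization for excellent two-dimensional local domains, every characteristic); the tokens `simultaneous-resolution-along-valuation`, `toroidalization-along-valuation`, `ramification-of-valuations` above are NOT consequences of the theorem (its own example is a finite morphism of regular surfaces — `cutkosky_isIntegralClosure`: `B` lies over `A`, so weak simultaneous resolution holds along `ν*`); a single Artin–Schreier layer along a valuation with `p`-divisible value group is locally monomializable in dimension two (Cutkosky 2023, Props. 3.9, 5.1, 5.3); every printed failure of LOCAL monomialization has defect `p²` in a non-Galois extension of degree `p² + 1` along an immediate non-discrete rank-one valuation. [cite: Cutkosky2015, Thm. 1.4] [cite: Cutkosky2023, Prop. 5.1] (status detail: established (theorem: Cutkosky, Math. Ann. 362 (2015); vendored as a named fact and PROVED downstream as `Cutkosky2014_holds`; the example's defining identities and its finiteness proved here).)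
- status: established
-/
def Cutkosky2014 : Prop :=
  ∀ (k : Type) [Field k] (p : ℕ) [CharP k p], p.Prime →
    (∃ a b c : k, a ≠ b ∧ b ≠ c ∧ a ≠ c) → ∀ n : ℕ, 2 ≤ n →
    ∃ (L : Type) (_ : Field L) (_ : Algebra k L) (K : IntermediateField k L),
      IsFunctionFieldOfDim k L n ∧ IsFunctionFieldOfDim k K n ∧
      FiniteDimensional K L ∧ Algebra.IsSeparable K L ∧
      ∃ (V : ValuationSubring L) (A B : Subalgebra k L),
        IsAlgebraicLocalRingOf k L K A ∧ IsAlgebraicLocalRingOf k L ⊤ B ∧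
        IsRegularLocalRing A ∧ IsRegularLocalRing B ∧
        Dominates k L A B ∧ ValuationDominates k L V B ∧
        NoWeakLocalMonomialization k L K V A B

/-! ## The printed example data (`n = 2`), proved as identities in `k[x, y]` -/

section Example

open MvPolynomial

variable (k : Type*) [CommRing k] (p : ℕ)

/-- `u = xᵖ(1 + y) ∈ k[x, y]` (`x = X 0`, `y = X 1`). [cite: Cutkosky2014, §3] -/
def cU : MvPolynomial (Fin 2) k := X 0 ^ p * (1 + X 1)

/-- `v = yᵖ + x ∈ k[x, y]`. [cite: Cutkosky2014, §3] -/
def cV : MvPolynomial (Fin 2) k := X 1 ^ p + X 0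

/-- **"`y` satisfies the relation `y^{p²+1} + y^{p²} − y vᵖ + (u − vᵖ) = 0`"** over
`K = k(u, v)` (so `K* = K(y)` is finite over `K`), in characteristic `p`. [cite: Cutkosky2014, §3] -/
theorem cutkosky_relation [hp : Fact p.Prime] [CharP k p] :
    (X 1 : MvPolynomial (Fin 2) k) ^ (p ^ 2 + 1) + X 1 ^ (p ^ 2) - X 1 * cV k p ^ p
      + (cU k p - cV k p ^ p) = 0 := by
  have : CharP (MvPolynomial (Fin 2) k) p := inferInstance
  have hv : cV k p ^ p = (X 1 : MvPolynomial (Fin 2) k) ^ (p ^ 2) + X 0 ^ p := by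
    rw [cV, add_pow_char, ← pow_mul, sq]
  rw [hv, cU]
  ring

/-- **"`K*` is separable over `K` since the Jacobian of `u` and `v` is not zero"**: in
characteristic `p`, `∂u/∂x = 0`, `∂u/∂y = xᵖ`, `∂v/∂x = 1`, `∂v/∂y = 0`, so the Jacobian
determinant `∂(u,v)/∂(x,y)` equals `−xᵖ`. [cite: Cutkosky2014, §3] -/
theorem cutkosky_jacobian [CharP k p] :
    pderiv 0 (cU k p) * pderiv 1 (cV k p) - pderiv 1 (cU k p) * pderiv 0 (cV k p) =
      -(X 0 : MvPolynomial (Fin 2) k) ^ p := by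
  have hpc : ((p : ℕ) : MvPolynomial (Fin 2) k) = 0 := CharP.cast_eq_zero _ p
  simp only [cU, cV, Derivation.leibniz, Derivation.leibniz_pow, map_add, pderiv_X,
    smul_eq_mul, nsmul_eq_mul, hpc]
  simp

/-- The Jacobian `−xᵖ` is non-zero (over a nontrivial `k`). [cite: Cutkosky2014, §3] -/
theorem cutkosky_jacobian_ne_zero [Nontrivial k] [CharP k p] :
    pderiv 0 (cU k p) * pderiv 1 (cV k p) - pderiv 1 (cU k p) * pderiv 0 (cV k p) ≠ 0 := by
  rw [cutkosky_jacobian, neg_ne_zero, X_pow_eq_monomial, Ne, monomial_eq_zero]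
  exact one_ne_zero

end Example

/-! ## The counterexample is a finite morphism of regular surfaces (barrier audit 2026-08-16)

`k[u, v] → k[x, y]`, `u = xᵖ(1 + y)`, `v = yᵖ + x`, is FINITE: `y` is a root of the monic
relation of §3 (`cutkosky_relation`) and `x = v − yᵖ`; since `k[x, y]` is integrally closed,
it is the integral closure of `k[u, v]` in `k(x, y) = K*`, so `B = k[x,y]_{(x,y)}` is the
localisation of the integral closure of `A = k[u,v]_{(u,v)}` at the centre of `ν*` ("`B` lies
over `A`", Cutkosky §2.1). Consequently Abhyankar's weak (local) simultaneous resolution holds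
for `(A, ν*)` in the very example in which local monomialization fails: Theorem 1.4 obstructs
the MONOMIAL form, not finiteness-with-regular-normalisation. -/

section Finite

open MvPolynomial

variable (k : Type*) [Field k] (p : ℕ)

/-- `u ∈ k[u, v] = k[xᵖ(1+y), yᵖ + x] ⊆ k[x, y]`. [folklore] -/
theorem cU_mem_adjoin : cU k p ∈ Algebra.adjoin k ({cU k p, cV k p} : Set (MvPolynomial (Fin 2) k)) :=
  Algebra.subset_adjoin (Set.mem_insert _ _)

/-- `v ∈ k[u, v] ⊆ k[x, y]`. [folklore] -/
theorem cV_mem_adjoin : cV k p ∈ Algebra.adjoin k ({cU k p, cV k p} : Set (MvPolynomial (Fin 2) k)) :=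
  Algebra.subset_adjoin (Set.mem_insert_of_mem _ rfl)

/-- **`y` is integral over `k[u, v]`**: it is a root of the monic polynomial
`T^{p²+1} + T^{p²} − vᵖ·T + (u − vᵖ) ∈ k[u, v][T]` ("`y` satisfies the relation
`y^{p²+1} + y^{p²} − y vᵖ + (u − vᵖ) = 0`, so `K*` is a finite extension of `K`"). PROVED from
`cutkosky_relation`. [cite: Cutkosky2014, §3] -/
theorem cutkosky_isIntegral_y [hp : Fact p.Prime] [CharP k p] :
    IsIntegral (Algebra.adjoin k ({cU k p, cV k p} : Set (MvPolynomial (Fin 2) k)))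
      (X 1 : MvPolynomial (Fin 2) k) := by
  set R := Algebra.adjoin k ({cU k p, cV k p} : Set (MvPolynomial (Fin 2) k)) with hR
  let u' : R := ⟨cU k p, cU_mem_adjoin k p⟩
  let v' : R := ⟨cV k p, cV_mem_adjoin k p⟩
  let q : Polynomial R :=
    Polynomial.X ^ (p ^ 2) - Polynomial.C (v' ^ p) * Polynomial.X + Polynomial.C (u' - v' ^ p)
  have hq : q.degree < ((p ^ 2 + 1 : ℕ) : WithBot ℕ) := by
    have h1 : ((1 : ℕ) : WithBot ℕ) ≤ ((p ^ 2 : ℕ) : WithBot ℕ) := by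
      exact_mod_cast Nat.one_le_pow 2 p hp.out.pos
    have h0 : ((0 : ℕ) : WithBot ℕ) ≤ ((p ^ 2 : ℕ) : WithBot ℕ) := by exact_mod_cast Nat.zero_le _
    have hlt : ((p ^ 2 : ℕ) : WithBot ℕ) < ((p ^ 2 + 1 : ℕ) : WithBot ℕ) := by
      exact_mod_cast Nat.lt_succ_self _
    refine lt_of_le_of_lt ?_ hlt
    refine (Polynomial.degree_add_le _ _).trans (max_le ((Polynomial.degree_sub_le _ _).trans
      (max_le (Polynomial.degree_X_pow_le _) ((Polynomial.degree_C_mul_X_le _).trans h1)))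
      (Polynomial.degree_C_le.trans h0))
  refine ⟨Polynomial.X ^ (p ^ 2 + 1) + q, Polynomial.monic_X_pow_add hq, ?_⟩
  have hrel := cutkosky_relation k p
  simp only [q, Polynomial.eval₂_add, Polynomial.eval₂_sub, Polynomial.eval₂_mul,
    Polynomial.eval₂_pow, Polynomial.eval₂_X, Polynomial.eval₂_C, map_sub, map_pow]
  change (X 1 : MvPolynomial (Fin 2) k) ^ (p ^ 2 + 1)
      + (X 1 ^ (p ^ 2) - cV k p ^ p * X 1 + (cU k p - cV k p ^ p)) = 0
  linear_combination hrel

/-- **`x = v − yᵖ` is integral over `k[u, v]`.** PROVED. [cite: Cutkosky2014, §3] -/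
theorem cutkosky_isIntegral_x [Fact p.Prime] [CharP k p] :
    IsIntegral (Algebra.adjoin k ({cU k p, cV k p} : Set (MvPolynomial (Fin 2) k)))
      (X 0 : MvPolynomial (Fin 2) k) := by
  have hx : (X 0 : MvPolynomial (Fin 2) k) = cV k p - X 1 ^ p := by simp [cV]
  rw [hx]
  exact (isIntegral_algebraMap (x := (⟨cV k p, cV_mem_adjoin k p⟩ :
    Algebra.adjoin k ({cU k p, cV k p} : Set (MvPolynomial (Fin 2) k))))).sub
    ((cutkosky_isIntegral_y k p).pow p)

/-- **`k[x, y]` is integral — hence, being finitely generated, FINITE — over `k[u, v]`**: the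
morphism `Spec k[x,y] → Spec k[u,v]` of Cutkosky's counterexample is a finite morphism of
regular surfaces. PROVED. [cite: Cutkosky2014, §3] -/
theorem cutkosky_algebra_isIntegral [Fact p.Prime] [CharP k p] :
    Algebra.IsIntegral (Algebra.adjoin k ({cU k p, cV k p} : Set (MvPolynomial (Fin 2) k)))
      (MvPolynomial (Fin 2) k) := by
  set R := Algebra.adjoin k ({cU k p, cV k p} : Set (MvPolynomial (Fin 2) k)) with hR
  refine ⟨fun f => ?_⟩
  induction f using MvPolynomial.induction_on with
  | C a =>
    have ha : (C a : MvPolynomial (Fin 2) k) ∈ R := by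
      rw [← MvPolynomial.algebraMap_eq]; exact R.algebraMap_mem a
    exact isIntegral_algebraMap (x := (⟨C a, ha⟩ : R))
  | add f g hf hg => exact hf.add hg
  | mul_X f i hf =>
    refine hf.mul ?_
    fin_cases i
    · exact cutkosky_isIntegral_x k p
    · exact cutkosky_isIntegral_y k p

/-- **`k[x, y]` is the integral closure of `k[u, v]` in `k(x, y) = K*`** (`k[x, y]` is integral
over `k[u, v]` and integrally closed, being factorial): so `B = k[x,y]_{(x,y)}` "lies over"
`A = k[u,v]_{(u,v)}` in the sense of Cutkosky §2.1 ("`S` lies over `R` if `S` is a localization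
of the integral closure `T` of `R` in `K*`") — the pair `(A, B)` of the counterexample is already
a (weak, local) simultaneous resolution along `ν*`, while `A' → B'` is never monomial. PROVED.
[cite: Cutkosky2014, §2.1 and §3] -/
theorem cutkosky_isIntegralClosure [Fact p.Prime] [CharP k p] :
    IsIntegralClosure (MvPolynomial (Fin 2) k)
      (Algebra.adjoin k ({cU k p, cV k p} : Set (MvPolynomial (Fin 2) k)))
      (FractionRing (MvPolynomial (Fin 2) k)) := by
  haveI := cutkosky_algebra_isIntegral k p
  refine ⟨IsFractionRing.injective _ _, fun {z} => ⟨fun hz => ?_, ?_⟩⟩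
  · have hz' : IsIntegral (MvPolynomial (Fin 2) k) z := hz.tower_top
    exact IsIntegrallyClosed.isIntegral_iff.mp hz'
  · rintro ⟨y, rfl⟩
    exact (Algebra.IsIntegral.isIntegral y).map
      (IsScalarTower.toAlgHom (Algebra.adjoin k ({cU k p, cV k p} : Set (MvPolynomial (Fin 2) k)))
        (MvPolynomial (Fin 2) k) (FractionRing (MvPolynomial (Fin 2) k)))

end Finite

/-! ## The barrier, narrowed: defect is the only obstruction in dimension two -/

/-- NAMED FACT — **the reach of `Cutkosky2014`, NARROWED (barrier audit 2026-08-16): in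
dimension two, weak local monomialization fails ONLY in the presence of defect.** This is the
contrapositive of Cutkosky's theorem that defect is the only obstruction for surfaces —
S. D. Cutkosky, *Ramification of valuations and local rings in positive characteristic*,
Comm. Algebra 44 (2016) 2828–2866 (= arXiv:1508.03362), Thm. 1.4, verbatim: "Suppose that `R`
is a 2 dimensional excellent local domain with quotient field `QF(R) = K`. Further suppose that
`K*` is a finite separable extension of `K` and `S` is a two dimensional excellent local domain
with quotient field `QF(S) = K*` such that `S` dominates `R`. Let `ν*` be a valuation of `K*`
which dominates `S` and let `ν` be the restriction of `ν*` to `K`. Suppose that the defect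
`δ(ν*/ν) = 0`. Then there exists a commutative diagram [`R → R₁`, `S → S₁ ⊂ V_{ν*}`] such that
the vertical arrows are products of quadratic transforms along `ν*` and `R₁ → S₁` is monomial.
The proof of the theorem actually produces stable strong monomialization" (over an
algebraically closed ground field: Cutkosky–Piltant, Adv. Math. 183 (2004), Thms. 7.3, 7.35) —
specialised to the data of `Cutkosky2014`: algebraic local rings `A ⊆ K`, `B ⊆ K* = L` of
dimension two (localisations of finitely generated algebras over a field are excellent), and
GLOBAL defectlessness of `(K, ν = ν*|K)` in `L` (`IsDefectlessIn`: `∑ᵢ eᵢ fᵢ = [L : K]` over all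
extensions `νᵢ` of `ν` to `L`, which for `L/K` finite separable says that every `νᵢ` — in
particular `ν*` — has trivial (henselian = Galois-closure) defect; Kuhlmann 2010, §1). The
quadratic transforms `A' = R₁`, `B' = S₁` are then regular algebraic local rings of `K`, `K*`,
`ν*` dominates `B'`, `B'` dominates `A'` (both are dominated by `ν*` and `A' ⊆ B'`), `A'`
dominates `A`, `B'` dominates `B`, and `A' → B'` is monomial (Def. 1.1 = `IsMonomialExtension`):
a weak local monomialization. HENCE, as stated: if `(A → B, ν*)` admits NO weak local
monomialization then `(K, ν)` is NOT defectless in `K*`. Users take `(h : Cutkosky2014Narrow)`.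
[cite: Cutkosky2015, Thm. 1.4] [cite: CutkoskyPiltant2004, Thm. 7.3 and Thm. 7.35] [cite: Kuhlmann2010, Section 1]

**BARRIER (D-0021 block) — narrowed replacement for the block of `Cutkosky2014` (audit
2026-08-16). The theorem `Cutkosky2014` is correct and PROVED in the tree (`Cutkosky2014_holds`);
what is narrowed is its technique class and its reach.**

- technique_class: local-monomialization weak-local-monomialization strong-local-monomialization monomialization-along-valuation monomial-extension cutkosky-monomialization-transfer (Zariski-local monomial forms of Def. 1.1 for a FIXED finite separable `K*/K`, to be reached birationally along a valuation whose extension `ν*/ν` has DEFECT; NOT in the class, see scope_caveats: simultaneous resolution along a valuation, toroidalization, étale-local / formal monomial forms, monomialization after enlarging `K*`, ramification theory of valuations as such)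
- blocks: a positive answer to Question 1.3 for ALL valuations at once in characteristic `p > 0` and dimension `≥ 2`; precisely, any claim of (weak) local monomialization for a class of dominant generically finite extensions `A → B` of two-dimensional algebraic regular local rings along valuations `ν*` that contains Cutkosky's defect-`p²` family — by the present fact every obstructed instance has `(K, ν)` NOT defectless in `K*`: classes of DEFECTLESS extensions are not blocked in dimension two (they are monomializable), and in dimension `≥ 3` the defectless case is open in positive characteristic (no theorem, no counterexample); defect alone is not sufficient for failure either (evasion (d)). [cite: Cutkosky2014, Thm. 1.4 and Question 1.3] [cite: Cutkosky2015, Thm. 1.4]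
- because: (i) the counterexample `Cutkosky2014` (PROVED downstream as `Cutkosky2014_holds`): `A = k[u,v]_{(u,v)} → B = k[x,y]_{(x,y)}`, `u = xᵖ(1+y)`, `v = yᵖ + x`, along `ν*` with `V_{ν*} = ∪ B_i`, value groups `Γ_{ν*} = Γ_ν = (1/p^∞)ℤ` (an IMMEDIATE extension, `e = f = 1`, non-discrete of rational rank 1), residue field `k`, defect `p²` ("`δ(ν*/ν) = 2`"), `K* = K(y)` with the monic relation `cutkosky_relation` of degree `p² + 1` (so `K*/K` is not Galois of degree `p`) [cite: Cutkosky2014, §3 (p. 7)]; (ii) conversely — this fact — defectless ⇒ stable strong monomialization in dimension two [cite: Cutkosky2015, Thm. 1.4]; (iii) the example is a FINITE morphism of regular surfaces: `k[x,y]` is the integral closure of `k[u,v]` in `k(x,y)` (`cutkosky_isIntegralClosure`, PROVED), so `B` lies over `A` and weak simultaneous resolution along `ν*` holds at the very first stage while no `A' → B'` is monomial. [cite: Cutkosky2014, §2.1 and §3]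
- evasions_known: (a) DEFECTLESS extensions of two-dimensional excellent local domains, every characteristic (also mixed): local and strong monomialization hold [cite: Cutkosky2015, Thm. 1.4] [cite: CutkoskyPiltant2004, Thm. 7.3 and Thm. 7.35] — in particular along Abhyankar valuations and discrete rank-one valuations ("The defect is equal to zero … if `V_ν` is a DVR" [cite: Cutkosky2014, §1.1]) and over any defectless (= stable) valued field `(K, ν)` (`IsDefectlessField`; e.g. `Kuhlmann2010Stability`); (b) TAME extensions (`p ∤ |Gal(K'/K)|` for a Galois closure `K'`, `k` perfect): monomial resolution of the surface morphism and local monomialization along every valuation, every characteristic ("From our theorem 1, we deduce a positive answer whenever `p` does not divide the order of a Galois closure of the quotient field of `S` over the quotient field of `R`") [cite: CutkoskyPiltant2000, Thm. 1 and Section 1]; (c) a single ARTIN–SCHREIER (Galois, degree `p`) extension `K → L` of two-dimensional algebraic function fields over an algebraically closed field, `ω` non-discrete of rational rank 1: above any `A → B` there is `R → S` of type 0 (`u = x, v = y`: unramified), type 1 (`u = x, v = yᵖγ + xΣ`) or type 2 (`u = γxᵖ, v = y`) [cite: Cutkosky2023, Prop. 3.9]; when `ω` is the unique extension of `ν` (stable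 complexity `p`; otherwise the stable forms are eventually of type 0) the types of the stable forms `R_r → S_r` along the valuation switch infinitely often iff the value group is `p`-divisible [cite: Cutkosky2023, Prop. 5.1 and Remark 3.8] and are eventually of type 2 iff the extension is defectless [cite: Cutkosky2023, Prop. 5.3]; types 0 and 2 ARE monomial (exponent matrices `1` and `diag(p, 1)`, reached by quadratic transforms), so local monomialization in the sense of Def. 1.2 (not the strong, stable form) holds for such an extension along every valuation (the discrete, rank-two and rational-rank-two valuations being defectless) unless `ω` is non-discrete of rational rank 1 with defect `p` AND a non-`p`-divisible value group, where the stable forms are eventually all of the non-monomial type 1 — a consequence assembled from the three cited propositions (numbering of arXiv:2111.12818), not printed there as a theorem; (d) defect alone does not kill it: the tower of two dependent defect Artin–Schreier extensions of [CP] Thm. 7.38 (defect `p²`) HAS a local monomialization though no strong one ("However, local monomialization is true for this example") [cite: Cutkosky2014, §1] [cite: ElhittiGhezzi2016, Section 1], and in the tower of two INDEPENDENT defect Artin–Schreier extensions it is again strong (not local) monomialization that is shown to fail [cite: Cutkosky2025, Thm. 4.1 (arXiv:2302.07710 numbering)]; (e) characteristic zero [cite: Cutkosky2014, §1.1]; (f)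 changing the problem: local uniformization after a finite [cite: KnafKuhlmann2009, Thm. 1.2] or purely inseparable [cite: Temkin2013, Thm. 1.3.2] extension of the function field — for the PAIR problem enlarging `K*` trivialises Question 1.3, so alteration-type statements are outside the class.
- scope_caveats: (a) printed failures of LOCAL (= weak) monomialization: only Cutkosky's family (`n ≥ 2` by adjoining indeterminates to the `n = 2` example) — defect `p²`, a non-Galois extension of degree `p² + 1`, an immediate non-discrete rank-one valuation with `p`-divisible value group `(1/p^∞)ℤ` and residue field `k`; printed failures of STRONG monomialization: towers of two defect Artin–Schreier extensions ([CP] Thm. 7.38, dependent; Cutkosky 2025, independent); NO failure of local monomialization is in print for a Galois extension of degree `p`, nor along a valuation with finitely generated or non-`p`-divisible value group (the latter is the one sub-case of (c) above left open); (b) the theorem is silent on — and its example satisfies — simultaneous resolution along `ν*` (`cutkosky_isIntegralClosure`: `B` is the localisation of the integral closure of `A`), so "finite with regular source and target" is no evasion and "simultaneous resolution" is not obstructed; (c) it is silent on toroidalization, on étale-local or formal monomial forms and on log-smoothness after alterations ("local monomialization … is a little stronger than what comes immediately from the assumption that toroidalization is possible" [cite: Cutkosky2023, Section 1]); (d) dimension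 `≥ 3`: only the transfer of the `n = 2` example by adjoining indeterminates is known; monomialization of defectless extensions in dimension `≥ 3` and positive characteristic is open; (e) this fact uses GLOBAL defectlessness (`IsDefectlessIn`, all extensions of `ν` to `L`), formally weaker information than the defect of `ν*` alone, and carries no hypothesis on the characteristic (in residue characteristic `0` every extension is defectless and the conclusion is never triggered); (f) rendering as in `Cutkosky2014` (set-theoretic local rings inside `L`; the weak form). (status detail: established — contrapositive of a printed theorem; vendored as a named fact, not yet discharged in the tree.)
- status: established
-/
def Cutkosky2014Narrow : Prop :=
  ∀ (k : Type) [Field k] (L : Type) [Field L] [Algebra k L] (K : IntermediateField k L),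
    FiniteDimensional K L → Algebra.IsSeparable K L →
    ∀ (V : ValuationSubring L) (A B : Subalgebra k L),
      IsAlgebraicLocalRingOf k L K A → IsAlgebraicLocalRingOf k L ⊤ B →
      ringKrullDim A = 2 → ringKrullDim B = 2 →
      Dominates k L A B → ValuationDominates k L V B →
      NoWeakLocalMonomialization k L K V A B →
      ¬ Literature.AlgebraicGeometry.Resolution.IsDefectlessIn K (V.comap (algebraMap K L)) L

end Cutkosky

end Literature.Barriers.ResolutionOfSingularities
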